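import Summits.CriticalPhenomena.PercolationContinuityZ3.Theorems.Transplant.PlanarSkeletonFrmScaledRayHolds
import HarnessLib

/-!
# INPUT(Cay(Γ; S)) in group-theoretic terms: a homomorphism `Γ → ℤ²` with rank-2 image and FINITELY GENERATED KERNEL — every such group, EVERY
# finite generating set, has `θ(p_c) = 0` modulo the one-type scaled node ALONE

builds on p205010 (kernel theorem, internal audit signed; external expert review pending) — nothing in this file uses p205010.  Every theorem below
is CONDITIONAL on the OPEN node `SamePDropOfSkeletonFrmScaled₁` (hypothesis `hN`; nothing is claimed about it) and on NOTHING ELSE.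
Lane `prim-bschramm`, seat `prim-bschramm-p4` gen 16 (PART C3 of `P4-GENERAL.md` §38.9: the class list in standard terms).  Helper file
(`--supports stmt-CriticalPhenomena-4575 --as helper`).

`CayleyScaled Γ S` asks for a chart `φ : Γ → ℤ²` (additive), two elements with independent images, and a finite generating set of `ker φ`; here this
is repackaged from a `MonoidHom` `φ : Γ →* Multiplicative (Site 2)`:
* `CayleyScaled.ofKerFG φ hrank hK S hS` — from `hrank` (two independent images) and `hK : φ.ker.FG`; `rank_of_surjective` — surjective `φ` has rank 2;
* **`criticalContinuity_of_kerFG`** / `…_of_surjective`: `θ_g(p_c(Cay(Γ; S))) = 0` at every vertex for EVERY finite generating `S` (and `θ_g(p) = 0`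
  for `p ≤ p_c`), modulo the node alone.
So the class of record is: **finitely generated groups `Γ` with a homomorphism to `ℤ²` of finite-index image and finitely generated kernel** — every
extension `1 → K → Γ → Q → 1` with `K` finitely generated and `Q ≤ ℤ²` of rank 2; this contains every finitely generated nilpotent group and every
polycyclic group with first Betti number `≥ 2` (their subgroups are finitely generated), `K ⋊ ℤ²` and `(K ⋊ ℤ) × ℤ` for every finitely generated `K`,
and the virtually-`ℤ²` groups mapping onto `ℤ²` — for ALL their Cayley graphs.  (Groups of exponential growth in the class are also covered
unconditionally by Hutchcroft's theorem; the node is only invoked through `continuity_of_frmScaledNode₁`, which dispatches on growth.)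
[cite: BenjaminiSchramm1996, Conj. 4; §2 (Cayley graphs)] [cite: Hutchcroft2016, Thm. 1] [cite: GrimmettPercolation1999, §12.1 p. 349]
-/

noncomputable section

namespace Summit.CriticalPhenomena.PercolationContinuityZ3.Theorems.Transplant

open SimpleGraph Subgroup Literature.Probability.LatticeModels Literature.Probability.Percolation
open scoped Classical

namespace CayleyScaled

variable {Γ : Type} [Group Γ]

/-- **`CayleyScaled` from a homomorphism with rank-2 image and finitely generated kernel**, for every finite generating set `S`.
[cite: BenjaminiSchramm1996, §2 (Cayley graphs)] -/
def ofKerFG (φ : Γ →* Multiplicative (Site 2))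
    (hrank : ∃ a b : Γ, MaxArea.det2 (Multiplicative.toAdd (φ a)) (Multiplicative.toAdd (φ b)) ≠ 0) (hK : φ.ker.FG)
    (S : Finset Γ) (hS : Subgroup.closure (S : Set Γ) = ⊤) : CayleyScaled Γ S :=
  ofRank (fun g => Multiplicative.toAdd (φ g)) (fun g h => by rw [φ.map_mul, toAdd_mul]) hS hrank hK.choose
    (fun k hk => by
      have hk' : k ∈ φ.ker := by rw [← hK.choose_spec]; exact Subgroup.subset_closure hk
      rw [MonoidHom.mem_ker] at hk'
      rw [hk', toAdd_one])
    (fun g hg => by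
      rw [hK.choose_spec, MonoidHom.mem_ker, ← ofAdd_toAdd (φ g), hg, ofAdd_zero])

/-- The chart of `ofKerFG` is `toAdd ∘ φ`. [folklore] -/
@[simp] theorem ofKerFG_φ (φ : Γ →* Multiplicative (Site 2))
    (hrank : ∃ a b : Γ, MaxArea.det2 (Multiplicative.toAdd (φ a)) (Multiplicative.toAdd (φ b)) ≠ 0) (hK : φ.ker.FG)
    (S : Finset Γ) (hS : Subgroup.closure (S : Set Γ) = ⊤) (g : Γ) : (ofKerFG φ hrank hK S hS).φ g = Multiplicative.toAdd (φ g) := rfl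

/-- A surjection onto `ℤ²` has rank-2 image (preimages of `e₀`, `e₁`). [folklore] -/
theorem rank_of_surjective (φ : Γ →* Multiplicative (Site 2)) (hφ : Function.Surjective φ) :
    ∃ a b : Γ, MaxArea.det2 (Multiplicative.toAdd (φ a)) (Multiplicative.toAdd (φ b)) ≠ 0 := by
  obtain ⟨a, ha⟩ := hφ (Multiplicative.ofAdd (Pi.single 0 1))
  obtain ⟨b, hb⟩ := hφ (Multiplicative.ofAdd (Pi.single 1 1))
  refine ⟨a, b, ?_⟩
  rw [ha, hb, toAdd_ofAdd, toAdd_ofAdd]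
  simp [MaxArea.det2]

/-- **THEOREM (modulo the scaled node ALONE): every group with a homomorphism to `ℤ²` of rank-2 image and finitely generated kernel, EVERY finite
generating set `S`: `θ_g(p_c(Cay(Γ; S))) = 0` at every vertex.** [cite: BenjaminiSchramm1996, Conj. 4; §2] -/
theorem criticalContinuity_of_kerFG (hN : SamePDropOfSkeletonFrmScaled₁) (φ : Γ →* Multiplicative (Site 2))
    (hrank : ∃ a b : Γ, MaxArea.det2 (Multiplicative.toAdd (φ a)) (Multiplicative.toAdd (φ b)) ≠ 0) (hK : φ.ker.FG)
    (S : Finset Γ) (hS : Subgroup.closure (S : Set Γ) = ⊤) (g : Γ) :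
    theta (mulCayley (↑S : Set Γ)) g (criticalProbIOf (mulCayley (↑S : Set Γ)) g) = 0 :=
  (ofKerFG φ hrank hK S hS).criticalContinuity hN g

/-- … and `θ_g(p) = 0` for every `p ≤ p_c`. [cite: BenjaminiSchramm1996, Conj. 4; §2] -/
theorem theta_eq_zero_of_le_of_kerFG (hN : SamePDropOfSkeletonFrmScaled₁) (φ : Γ →* Multiplicative (Site 2))
    (hrank : ∃ a b : Γ, MaxArea.det2 (Multiplicative.toAdd (φ a)) (Multiplicative.toAdd (φ b)) ≠ 0) (hK : φ.ker.FG)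
    (S : Finset Γ) (hS : Subgroup.closure (S : Set Γ) = ⊤) (g : Γ) {p : unitInterval}
    (hp : (p : ℝ) ≤ criticalProb (mulCayley (↑S : Set Γ)) g) : theta (mulCayley (↑S : Set Γ)) g p = 0 :=
  (ofKerFG φ hrank hK S hS).theta_eq_zero_of_le hN g hp

/-- **THEOREM (modulo the scaled node ALONE): every extension `1 → K → Γ → ℤ² → 1` with `K` finitely generated, EVERY finite generating set `S` of `Γ`:
`θ_g(p_c(Cay(Γ; S))) = 0`.** [cite: BenjaminiSchramm1996, Conj. 4; §2] -/
theorem criticalContinuity_of_surjective (hN : SamePDropOfSkeletonFrmScaled₁) (φ : Γ →* Multiplicative (Site 2))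
    (hφ : Function.Surjective φ) (hK : φ.ker.FG) (S : Finset Γ) (hS : Subgroup.closure (S : Set Γ) = ⊤) (g : Γ) :
    theta (mulCayley (↑S : Set Γ)) g (criticalProbIOf (mulCayley (↑S : Set Γ)) g) = 0 :=
  criticalContinuity_of_kerFG hN φ (rank_of_surjective φ hφ) hK S hS g

/-- … and `θ_g(p) = 0` for every `p ≤ p_c`. [cite: BenjaminiSchramm1996, Conj. 4; §2] -/
theorem theta_eq_zero_of_le_of_surjective (hN : SamePDropOfSkeletonFrmScaled₁) (φ : Γ →* Multiplicative (Site 2))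
    (hφ : Function.Surjective φ) (hK : φ.ker.FG) (S : Finset Γ) (hS : Subgroup.closure (S : Set Γ) = ⊤) (g : Γ) {p : unitInterval}
    (hp : (p : ℝ) ≤ criticalProb (mulCayley (↑S : Set Γ)) g) : theta (mulCayley (↑S : Set Γ)) g p = 0 :=
  theta_eq_zero_of_le_of_kerFG hN φ (rank_of_surjective φ hφ) hK S hS g hp

end CayleyScaled

end Summit.CriticalPhenomena.PercolationContinuityZ3.Theorems.Transplant

end
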